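import Summits.BirchSwinnertonDyer.Rank1Residual.X4.KimDefectParity
import HarnessLib

/-!
# The `p`-part of BSD in analytic rank 0 at `p ≥ 5` IS "`ord_p #Ш_an` even AND Kim's Conjecture 1.10
# WITHIN ONE" — per pair, and the X4 ∧ r0 END STATE at `p ≥ 5` restated with the parity law
# (cell `b2b-bsdres`, seat additive-p4 gen 19, line V37; CLASS-CLOSURE §3.2 N10 ∩ X4, E1 "exact
# missing statement" sharpened by Cassels–Tate)

HONEST FRAMING (cell `b2b-bsdres`, run/shared/lean/b2b/bsd-rank1-residual/, verbatim in every
file): the goal of the cell is to DELETE the COMBINATION-SHAPED residual classes of the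
Birch–Swinnerton-Dyer formula for ALL analytic-rank `≤ 1` elliptic curves over `ℚ` — "full BSD
formula for every rank `≤ 1` curve in class `C`" assembled STRICTLY from published theorems — so
that the rank-`≤ 1` remainder becomes exactly the CONSTRUCTION-SHAPED classes, which are TYPED
(missing-input `Prop`s), NOT attempted. This is not "finishing BSD". Sub-cell additive-p4 (X3♯/X4♯
direct): research route on the CONSTRUCTION-SHAPED class X4; the label X4 and the marks of
RESIDUAL-MAP §I N10/N11 are UNCHANGED; nothing is booked. Theorems only (no definition, no named
fact minted). Published inputs are explicit named-fact HYPOTHESES: `hKimk` (p249207), `hE67c`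
(p250376) — Kim 2026 Thm. 1.8 (6) readings, flags `Kim-(6)-partial-reading` /
`Kim2026-(6)-cyclic-reading` —, Cassels' theorem `hCT`, GZK `hGZK`, modularity `hmod`. Kim's
Conjecture 1.10 appears only through n1011-p12's typed predicate `X4.KimTamagawaDefectAt` and the
invariant `kuriharaPartialInfty` — never assumed.

## What this file proves

* §1 `missingPPartAt_iff_even_and_kimDefect_within_one_of_kimFacts_of_casselsTate_of_five_le` —
  per pair, class-free, `p ≥ 5`, analytic rank `0`, `ρ̄_{E,p}` onto, conductor-level datum `D` with
  `p ∤ c_D` and the period transfer, ANY reduction at `p`: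
  **`Typed.MissingPPartAt W p ⟺ ord_p #Ш_an is EVEN ∧ |∂^{(∞)}(δ̃_{D.f}) − ord_p ∏_v c_v| ≤ 1`.**
  Gen 17's iff said `MissingPPartAt ⟺ ∂^{(∞)} = ord_p ∏_v c_v` (Conjecture 1.10 at the pair); the
  parity law of `X4/KimDefectParity.lean` (Kim (6) + Cassels: `∂^{(∞)} ≡ ord_p ∏c + ord_p #Ш_an (mod 2)`)
  relaxes the right-hand side to "within one" at the price of the evenness of `ord_p #Ш_an`, which
  `MissingPPartAt` forces anyway (`#Ш` is a square). `…_iff_kimDefect_within_one_of_shaAn_unit_…`: on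
  the `p ∤ #Ш_an` rows (all of TAM-DEFECT₂♭) `MissingPPartAt ⟺ ord_p ∏_v c_v ≤ ∂^{(∞)} + 1`.
* §2 `x4RankZero_fiveLe_iff_kimDefectWithinOne_of_kimFacts_of_casselsTate` — the X4 ∧ r0 END STATE at
  `p ≥ 5` (gen 17's `x4RankZero_fiveLe_iff_kimTamagawaDefect_of_kimFacts`) with clause (i)
  "Conjecture 1.10 on every conductor-level datum row" REPLACED by "`ord_p #Ш_an` even and Conjecture
  1.10 WITHIN ONE on every conductor-level datum row"; clause (ii) (the datum-less residue) unchanged.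
  So the irreducible residue of N10 ∩ X4 ∩ surj at `p ≥ 5` is named one notch more sharply: HALF of
  the `≥` direction of Conjecture 1.10 (every OTHER value of `∂^{(∞)}` is excluded by parity).
  X4 stays CONSTRUCTION-SHAPED; nothing booked.

References: C.-H. Kim, Amer. J. Math. 148 (2026) = arXiv:2203.12159v4, Thm. 1.9 (6), §1.5.1,
Conj. 1.10 [Kim2022StructureSelmer]; Cassels 1962 / Silverman *AEC* Thm. X.4.14 [SilvermanAEC2009];
Miller 2011 Def. 1.1 [Miller2011LMS]; siblings `X4/KimDefectParity.lean` (gen 19),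
`X4/KimShaLengthFiveLe{,EndState}.lean` (gen 17).
-/

noncomputable section

open scoped Classical MatrixGroups ModularForm

open Complex CongruenceSubgroup WeierstrassCurve Literature.NumberTheory.EllipticCurves
  Literature.NumberTheory.EllipticCurves.ModularForms
  Literature.NumberTheory.EllipticCurves.Rank1Residual
  Literature.NumberTheory.EllipticCurves.Rank1Residual.Typed

namespace Summit.BirchSwinnertonDyer.Rank1Residual.X4

section PerPair

variable (W : WeierstrassCurve ℚ) [W.IsElliptic] [W.IsGloballyMinimal] (p : ℕ) [Fact p.Prime]

/-! ### §1 Per pair: `MissingPPartAt ⟺ even ∧ within one` -/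

omit [W.IsGloballyMinimal] in
/-- **`Typed.MissingPPartAt` forces `ord_p #Ш_an` EVEN** (analytic rank `≤ 1`, GZK for the finiteness
of `Ш`, Cassels `hCT` for the squareness of `#Ш`): `#Ш_an = q` with `ord_p q = ord_p #Ш`, even.
[cite: SilvermanAEC2009, Thm. X.4.14] [cite: Miller2011LMS, Def. 1.1 (arXiv:1010.2431 p. 3)] -/
theorem exists_even_padicValRat_shaAn_of_missingPPartAt_of_casselsTate
    (hCT : exists_casselsTate_pairing (K := ℚ))
    (hGZK : rank_eq_analyticRank_of_analyticRank_le_one) (hr : W.analyticRank ≤ 1)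
    (h : MissingPPartAt W p) : ∃ q : ℚ, shaAn W = (q : ℂ) ∧ Even (padicValRat p q) := by
  obtain ⟨q, hq, hv⟩ := h
  have hfin : Finite W.sha := (hGZK W hr).2
  haveI : Finite W.sha := hfin
  obtain ⟨k, hk⟩ := even_padicValNat_card_shaPrimary_of_casselsTate W p hCT hfin
  rw [padicValNat_card_addPrimaryComponent, ← WeierstrassCurve.shaOrder] at hk
  exact ⟨q, hq, ⟨k, by rw [hv, hk, Nat.cast_add]⟩⟩

/-- **`Typed.MissingPPartAt W p ⟺ ord_p #Ш_an EVEN ∧ Conjecture 1.10 WITHIN ONE at the pair`** —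
`p ≥ 5`, analytic rank `0`, `ρ̄_{E,p}` onto, conductor-level datum `D` (`p ∤ c_D`, period transfer),
ANY reduction at `p`; Kim's (6) (`hKimk`, `hE67c`), Cassels (`hCT`), GZK, modularity. The
right-hand side: `#Ш_an = q'` with `ord_p q'` even, `∂^{(∞)}(δ̃_{D.f}) = d ∈ ℕ`,
`ord_p ∏_v c_v ≤ d + 1` and `d ≤ ord_p ∏_v c_v + 1`. (`→`: gen 17's iff gives `d = ord_p ∏c`;
evenness by Cassels. `←`: the parity law excludes `d = ord_p ∏c ± 1`.)
[cite: Kim2022StructureSelmer, Thm. 1.9 (6) and Conj. 1.10 (PDF p. 8)] [cite: SilvermanAEC2009, Thm. X.4.14]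
[cite: Miller2011LMS, Def. 1.1] -/
theorem missingPPartAt_iff_even_and_kimDefect_within_one_of_kimFacts_of_casselsTate_of_five_le
    (hKimk : Kim2026.rankZero_le_padicValNat_sha_of_kuriharaNumber_ne_zero)
    (hE67c : Kim2026.rankZero_padicValNat_sha_add_le_of_forall_pow_dvd_kuriharaNumber_cyclicLevel)
    (hCT : exists_casselsTate_pairing (K := ℚ))
    (hGZK : rank_eq_analyticRank_of_analyticRank_le_one) (hmod : hasEntireLFunction_rat)
    (hp : 5 ≤ p) (hr : W.analyticRank = 0) (hsurj : W.HasSurjectiveModNGaloisRep p)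
    {N : ℕ} [NeZero N] (D : ModularParametrizationData W N) (hN : W.conductorNorm ℤ = N)
    (hc : ¬ (p : ℤ) ∣ D.maninConstant)
    (hper : ∃ u : ℚ, ‖(u : ℚ_[p])‖ = 1 ∧ W.realPeriodRat = u * plusPeriod D.f) :
    MissingPPartAt W p ↔
      ∃ (q' : ℚ) (d : ℕ), shaAn W = (q' : ℂ) ∧ Even (padicValRat p q') ∧
        kuriharaPartialInfty W p D.f = d ∧
        padicValNat p W.tamagawaProduct ≤ d + 1 ∧ d ≤ padicValNat p W.tamagawaProduct + 1 := by
  constructor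
  · intro h
    obtain ⟨q', hq', hev⟩ := exists_even_padicValRat_shaAn_of_missingPPartAt_of_casselsTate W p hCT
      hGZK (by rw [hr]; exact zero_le_one) h
    have hK : KimTamagawaDefectAt W p D.f :=
      kimTamagawaDefectAt_of_missingPPartAt_of_kimFacts_of_five_le W p hKimk hE67c hGZK hmod hp hr hsurj
        D hN hc hper h
    rw [KimTamagawaDefectAt] at hK
    exact ⟨q', padicValNat p W.tamagawaProduct, hq', hev, hK, by omega, by omega⟩
  · rintro ⟨q', d, hq', hev, hd, hge, hle⟩
    refine missingPPartAt_of_kimDefect_within_one_of_even W p hKimk hE67c hCT hGZK hmod hp hr hsurj D hN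
      hc hper hq' hev ?_ ?_
    · rw [hd]; exact_mod_cast hge
    · rw [hd]; exact_mod_cast hle

/-- **On a `p ∤ #Ш_an` row: `Typed.MissingPPartAt W p ⟺ ord_p ∏_v c_v ≤ ∂^{(∞)}(δ̃_{D.f}) + 1`**
(`p ≥ 5`, same hypotheses; `#Ш_an = q'`, `ord_p q' = 0`). The TAM-DEFECT₂♭ rows' missing input,
ONE NOTCH WEAKER than the `≥` half of Conjecture 1.10 (gen 17: `⟺ ord_p ∏_v c_v ≤ ∂^{(∞)}`).
[cite: Kim2022StructureSelmer, Thm. 1.9 (6) and Conj. 1.10 (PDF p. 8)] [cite: SilvermanAEC2009, Thm. X.4.14]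
[cite: Miller2011LMS, Def. 1.1] -/
theorem missingPPartAt_iff_tamagawa_le_kimDefect_add_one_of_shaAn_unit_of_five_le
    (hKimk : Kim2026.rankZero_le_padicValNat_sha_of_kuriharaNumber_ne_zero)
    (hE67c : Kim2026.rankZero_padicValNat_sha_add_le_of_forall_pow_dvd_kuriharaNumber_cyclicLevel)
    (hCT : exists_casselsTate_pairing (K := ℚ))
    (hGZK : rank_eq_analyticRank_of_analyticRank_le_one) (hmod : hasEntireLFunction_rat)
    (hp : 5 ≤ p) (hr : W.analyticRank = 0) (hsurj : W.HasSurjectiveModNGaloisRep p)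
    {N : ℕ} [NeZero N] (D : ModularParametrizationData W N) (hN : W.conductorNorm ℤ = N)
    (hc : ¬ (p : ℤ) ∣ D.maninConstant)
    (hper : ∃ u : ℚ, ‖(u : ℚ_[p])‖ = 1 ∧ W.realPeriodRat = u * plusPeriod D.f)
    {q' : ℚ} (hq' : shaAn W = (q' : ℂ)) (hv : padicValRat p q' = 0) :
    MissingPPartAt W p ↔
      (padicValNat p W.tamagawaProduct : ℕ∞) ≤ kuriharaPartialInfty W p D.f + 1 := by
  have hL : W.entireLFunction 1 ≠ 0 := (W.analyticRank_eq_zero_iff_holds (hmod W)).mp hr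
  obtain ⟨hmw, hfin⟩ := hGZK W (by rw [hr]; exact zero_le_one)
  haveI : Finite W.sha := hfin
  have hev : Even (padicValRat p q') := by rw [hv]; exact ⟨0, rfl⟩
  constructor
  · intro h
    have hK : KimTamagawaDefectAt W p D.f :=
      kimTamagawaDefectAt_of_missingPPartAt_of_kimFacts_of_five_le W p hKimk hE67c hGZK hmod hp hr hsurj
        D hN hc hper h
    rw [KimTamagawaDefectAt] at hK
    rw [hK]
    exact le_self_add
  · intro hge
    have hup := missingUpperBoundAt_of_tamagawa_le_kimDefect_add_one_of_even W p hKimk hE67c hCT hGZK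
      hmod hp hr hsurj D hN hc hper hq' hev hge
    have hlow : MissingLowerBoundAt W p := ⟨q', hq', by rw [hv]; exact_mod_cast Nat.zero_le _⟩
    exact missingPPartAt_of_lower_of_upper W p hlow hup

end PerPair

/-! ### §2 The X4 ∧ r0 END STATE at `p ≥ 5` with the parity law -/

section EndState

/-- **THE X4 ∧ `r_an = 0` END STATE AT `p ≥ 5`, PARITY FORM.** Granted Kim's (6) readings (`hKimk`,
`hE67c`), Cassels (`hCT`), GZK and modularity, the following are EQUIVALENT:
(LHS) `Typed.MissingPPartAt W p` on EVERY X4 ∧ `r_an = 0` ∧ surj(p) ∧ `p ≥ 5` pair;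
(RHS) (i) on every such pair and every conductor-level datum `D` with `p ∤ c_D` and the period
transfer: **`ord_p #Ш_an` is even AND Conjecture 1.10 holds WITHIN ONE at `(W, p, D.f)`**, and
(ii) `MissingPPartAt` on the pairs admitting NO such datum (the datum-less residue, as in gen 17).
Compared with gen 17's `x4RankZero_fiveLe_iff_kimTamagawaDefect_of_kimFacts`, clause (i) asks for
HALF of Conjecture 1.10: parity (Kim (6) + Cassels) supplies the other half. X4 stays
CONSTRUCTION-SHAPED; nothing booked. [cite: Kim2022StructureSelmer, Thm. 1.9 (6) and Conj. 1.10 (PDF p. 8)]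
[cite: SilvermanAEC2009, Thm. X.4.14] [cite: Miller2011LMS, §1 and Def. 1.1] -/
theorem x4RankZero_fiveLe_iff_kimDefectWithinOne_of_kimFacts_of_casselsTate
    (hKimk : Kim2026.rankZero_le_padicValNat_sha_of_kuriharaNumber_ne_zero)
    (hE67c : Kim2026.rankZero_padicValNat_sha_add_le_of_forall_pow_dvd_kuriharaNumber_cyclicLevel)
    (hCT : exists_casselsTate_pairing (K := ℚ))
    (hGZK : rank_eq_analyticRank_of_analyticRank_le_one) (hmod : hasEntireLFunction_rat) :
    (∀ (W : WeierstrassCurve ℚ) [W.IsElliptic] [W.IsGloballyMinimal] (p : ℕ) [Fact p.Prime],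
        5 ≤ p → W.analyticRank = 0 → ClassX4 W p → Surj W p → MissingPPartAt W p) ↔
      (∀ (W : WeierstrassCurve ℚ) [W.IsElliptic] [W.IsGloballyMinimal] (p : ℕ) [Fact p.Prime],
          5 ≤ p → W.analyticRank = 0 → ClassX4 W p → Surj W p →
          ∀ {N : ℕ} [NeZero N] (D : ModularParametrizationData W N), W.conductorNorm ℤ = N →
          ¬ (p : ℤ) ∣ D.maninConstant →
          (∃ u : ℚ, ‖(u : ℚ_[p])‖ = 1 ∧ W.realPeriodRat = u * plusPeriod D.f) →
          ∃ (q' : ℚ) (d : ℕ), shaAn W = (q' : ℂ) ∧ Even (padicValRat p q') ∧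
            kuriharaPartialInfty W p D.f = d ∧
            padicValNat p W.tamagawaProduct ≤ d + 1 ∧ d ≤ padicValNat p W.tamagawaProduct + 1) ∧
      (∀ (W : WeierstrassCurve ℚ) [W.IsElliptic] [W.IsGloballyMinimal] (p : ℕ) [Fact p.Prime],
          5 ≤ p → W.analyticRank = 0 → ClassX4 W p → Surj W p →
          (∀ (N : ℕ) [NeZero N] (D : ModularParametrizationData W N), W.conductorNorm ℤ ≠ N ∨
            (p : ℤ) ∣ D.maninConstant ∨
            ¬ ∃ u : ℚ, ‖(u : ℚ_[p])‖ = 1 ∧ W.realPeriodRat = u * plusPeriod D.f) →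
          MissingPPartAt W p) := by
  rw [x4RankZero_fiveLe_iff_kimTamagawaDefect_of_kimFacts hKimk hE67c hGZK hmod]
  refine and_congr_left fun _ => ?_
  constructor
  · intro hconj W _ _ p _ hp hr hX hs N _ D hN hc hper
    have hK := hconj W p hp hr hX hs D hN hc hper
    have hmp := (missingPPartAt_iff_kimTamagawaDefectAt_of_kimFacts_of_five_le W p hKimk hE67c hGZK hmod
      hp hr hs D hN hc hper).mpr hK
    exact (missingPPartAt_iff_even_and_kimDefect_within_one_of_kimFacts_of_casselsTate_of_five_le W p
      hKimk hE67c hCT hGZK hmod hp hr hs D hN hc hper).mp hmp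
  · intro hwithin W _ _ p _ hp hr hX hs N _ D hN hc hper
    have hmp := (missingPPartAt_iff_even_and_kimDefect_within_one_of_kimFacts_of_casselsTate_of_five_le
      W p hKimk hE67c hCT hGZK hmod hp hr hs D hN hc hper).mpr (hwithin W p hp hr hX hs D hN hc hper)
    exact kimTamagawaDefectAt_of_missingPPartAt_of_kimFacts_of_five_le W p hKimk hE67c hGZK hmod hp hr
      hs D hN hc hper hmp

end EndState

end Summit.BirchSwinnertonDyer.Rank1Residual.X4

end
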